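import Mathlib
import Summits.ResolutionOfSingularities.ResolutionOfSingularities.Theorems.RadicialJungCleanModelsCleanPermissibleCriteria
import HarnessLib

/-!
# Route `RadicialJung`, crux `CleanModels` (stmt-ResolutionOfSingularities-15917), line `Sketch` rev 20, stub 4e
# `stub_cleanPrincipalization3`: toward L7b — THE CHARGED LANDING (end of phase 1 ⇒ clean-permissible)

Memo `Cruxes/CleanModels/Lines/Sketch-memo-4e-cleanPermissible.md` rev 11.3 §2.3 `(μ,1)` (a), rev 10 §3: at the end of L7b phase 1 (after `k`
point blowing ups following the curve, `contact_along_pointChain` / `isUnit_contact_drop_one`, ✓ p690181/p690623/p691104) the representative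
of the `K^p`-line of `G` reads `u · e^N` at the point `x_k` of the strict transform `C̃`, with `u` a unit (the old component has left the
curve) and `e` the exceptional coordinate, TRANSVERSAL to `C̃`: `𝓘_{C̃,x_k} + (e) = 𝔪`.  If the landing exceptional divisor is CHARGED
(`p ∤ N`), the line is clean-permissible at `x_k` for the centre `C̃` — `cleanPermissibleAt_of_split` (✓ p685976) with no component through the
centre and the single transversal component `e`.  (If `p ∣ N` one is in the unit case: form (2) is `cleanPermissibleAt_of_unit`, form (3)
starts phase 2 of L7b.)  Pure local algebra.
* `isRsopPart_quotient_singleton_of_sup_span_eq` — `P + (e) = 𝔪`, `dim R/P = 1` ⇒ `ē` is a regular system of parameters of `R/P`.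
* `cleanPermissibleAt_of_chargedLanding`.

Honest framing: OURS, elementary; nothing here proves resolution in characteristic `p` or any case of `CleanModels`.
-/

noncomputable section

set_option linter.dupNamespace false -- mandated namespace of this single-conjunct summit

open IsLocalRing
open Literature.AlgebraicGeometry.Resolution

universe u

namespace Summit.ResolutionOfSingularities.ResolutionOfSingularities.Theorems.RadicialJung.CleanModels

/-- If `P + (e) = 𝔪_R` and `R/P` is a regular local ring of dimension one, the image of `e` is (by itself) a regular system of parameters of
`R/P`. [cite: Matsumura1987, Thm. 14.2] -/
theorem isRsopPart_quotient_singleton_of_sup_span_eq {R : Type u} [CommRing R] [IsLocalRing R] (P : Ideal R)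
    [IsRegularLocalRing (R ⧸ P)] (hP1 : ringKrullDim (R ⧸ P) = 1) (e : R) (he : P ⊔ Ideal.span {e} = maximalIdeal R) :
    haveI : IsLocalRing (R ⧸ P) := inferInstance
    IsRsopPart (Ideal.Quotient.mk P ∘ ![e]) := by
  haveI : IsLocalRing (R ⧸ P) := inferInstance
  refine ⟨inferInstance, 0, Fin.elim0, by rw [hP1]; rfl, ?_⟩
  rw [Set.range_eq_empty Fin.elim0, Set.union_empty]
  have hrange : Set.range (Ideal.Quotient.mk P ∘ ![e]) = {Ideal.Quotient.mk P e} := by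
    ext y
    simp only [Set.mem_range, Function.comp_apply, Set.mem_singleton_iff]
    constructor
    · rintro ⟨i, rfl⟩
      fin_cases i
      rfl
    · rintro rfl
      exact ⟨0, rfl⟩
  rw [hrange, ← map_maximalIdeal_of_surjective (Ideal.Quotient.mk P) Ideal.Quotient.mk_surjective, ← he, Ideal.map_sup,
    Ideal.map_quotient_self, bot_sup_eq, Ideal.map_span, Set.image_singleton]

/-- **Charged landing ⇒ clean-permissible.**  `R` regular local read in `F` by `f`, `P` an ideal with `R/P` regular of dimension one (the germ
of a regular curve), `e ∈ R` with `P + (e) = 𝔪` (a coordinate transversal to the curve), and a non-trivial representative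
`Σ_j c_j^p G^j = f(u · e^N)` of the `F^p`-line of `G` with `u` a unit and `p ∤ N`: then the line is clean-permissible at `R` for `P`.
[cite: Matsumura1987, Thm. 14.2] [cite: BierstoneGrigorievMilmanWlodarczyk2011, Def. 3.1.3 (2)] -/
theorem cleanPermissibleAt_of_chargedLanding {R F : Type u} [CommRing R] [IsRegularLocalRing R] [CommRing F] (p : ℕ) (f : R →+* F)
    (G : F) (P : Ideal R) [IsRegularLocalRing (R ⧸ P)] (hP1 : ringKrullDim (R ⧸ P) = 1)
    (cc : Fin p → F) (hcc : ∃ j : Fin p, (j : ℕ) ≠ 0 ∧ cc j ≠ 0) (e : R) (he : P ⊔ Ideal.span {e} = maximalIdeal R)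
    (N : ℕ) (hN : ¬ p ∣ N) (u : R) (hu : IsUnit u) (hX : (∑ j : Fin p, cc j ^ p * G ^ (j : ℕ)) = f (u * e ^ N)) :
    CleanPermissibleAt p f G P := by
  classical
  have ha : IsRsopPart (Fin.elim0 : Fin 0 → R) :=
    ⟨inferInstance, (maximalIdeal R).spanFinrank, Classical.choose (exists_regularSystemOfParameters (R := R)), by
      rw [zero_add]; exact (IsRegularLocalRing.spanFinrank_maximalIdeal (R := R)).symm, by
      rw [Set.range_eq_empty Fin.elim0, Set.empty_union]
      exact Classical.choose_spec (exists_regularSystemOfParameters (R := R))⟩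
  have hem : e ∈ maximalIdeal R := he.le (Ideal.mem_sup_right (Ideal.mem_span_singleton_self e))
  have hb := isRsopPart_quotient_singleton_of_sup_span_eq P hP1 e he
  refine cleanPermissibleAt_of_split p f G P cc hcc Fin.elim0 ![e] ha (fun k => Fin.elim0 k) (fun k => ?_) hb
    Fin.elim0 ![N] (Or.inr ⟨0, by simpa using hN⟩) u hu ?_
  · fin_cases k; simpa using hem
  · rw [hX]
    simp

end Summit.ResolutionOfSingularities.ResolutionOfSingularities.Theorems.RadicialJung.CleanModels

end
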